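import Summits.BirchSwinnertonDyer.BirchSwinnertonDyer.Theorems.ByReductionTypeAtTwoSupersingularFlatRoadLineV9
import Summits.BirchSwinnertonDyer.Rank1Residual.Additive.LocalTowerKernelCardEqTamagawaCyclotomic
import Literature.NumberTheory.EllipticCurves.Sprung2024.ChromaticKerGLocalBoundProofs
import Literature.NumberTheory.DiophantineGeometry.LocalReductionFiniteBadPlacesProofs
import Literature.NumberTheory.EllipticCurves.TamagawaSubgroupProofs
import Literature.NumberTheory.EllipticCurves.TamagawaFiniteIndexProofs
import HarnessLib

/-!
# `#ker g♭ ∣ p^{ord_p ∏ c_ℓ}` for Sprung's ♭ Selmer group over `ℚ` under the explicit Honda clauses, ANY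
# prime `p` (so `p = 2`) — the Poitou–Tate-free half of COUNT♭, and the arithmetic of Greenberg's remark

Seat `bsd-2adic-ss-1` GEN 11, crux `SupersingularRankZeroAtTwo` (item stmt-BirchSwinnertonDyer-19097, route
`ByReductionTypeAtTwo`, rung K4), line `signed_halves_two` v9 (GEN 10), stub (5) `stub_pmFlatDataV9`, conjunct
COUNT♭@2 = Sprung 2024 Lemma 5.5 READ AT 2 on `Sel♭` (`#(A♭_0/Sel_0) · #E[2^∞]^{Γ_ℚ} = 2^{ord₂ ∏ c_ℓ} ·
#(Sel♭_∞)_γ`; Greenberg LNM 1716 Lemmas 4.4 + 4.7, Cassels–Poitou–Tate, `Sel ↦ Sel♭`) — the ONE displayed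
count modulo which EC♭@2 is the kernel theorem `SSFlatRoad.flatEulerChar_two`. Part 1 of 2 (part 2:
`…FlatCountUnpacked.lean` — COUNT♭ ⟺ Cassels' count ∧ `(Sel♭_∞)_Γ = 0`).

WHAT IS PROVED (namespace `…Theorems.SSFlatEC`; `W/ℚ` elliptic, globally minimal; ANY prime `p`; a
CYCLOTOMIC `ℤ_p`-extension `κ`; the place `v ∋ p`; a local `g` restricting to a generator; local points
`c` with the Honda clauses of GEN 10 (levels, `n ≥ 1` trace relation with `a_p`, `p ∣ a_p`, level-`0`
generation ON `c_0`); no `p`-torsion in `E(ℚ_∞·ℚ_p)` — Sprung 2012 Lemma 2.3, a tree theorem at `2`):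
* `mul_one_eq_pow_mul_iff` — the arithmetic of Greenberg's remark p. 104: `k ∣ p^t`, `s ≥ 1`,
  `k · 1 = p^t · s` iff `k = p^t ∧ s = 1`;
* `natCard_flatKerG_dvd_pow_padicValNat_tamagawaProduct` — **`#ker g♭ ∣ p^{ord_p ∏ c_ℓ}`**, where
  `ker g♭ = A♭_0/Sel_0`, `A♭_0 = h_0⁻¹(Sel♭(E/ℚ_∞))`: Greenberg p. 104 «`ker(g) = ker(r) ∩ 𝒢_E^Σ(F)`»,
  `|ker(r)| = ∏_v |ker(r_v)|`, with `|ker(r_ℓ)| = c_ℓ^{(p)}` at bad `ℓ ≠ p` (p. 88; kernel: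
  `Rank1Residual.Additive.natCard_localTowerKerPrimary_zero_eq_pow_of_isCyclotomic`), `ker(r_p) = 0` for the
  ♭ condition ("`r_p` injective", GEN 10 `mem_localKerOver_of_flat_rat`, any `p`) and NOTHING at the
  archimedean place: in the tree's `selmerGroupOver` the archimedean conditions are imposed at every
  conjugate and `ℚ_∞/ℚ` is totally real, so the K3 lane's
  `natCard_quotient_selmerLayer_zero_dvd_prod_natCard_localTowerKerPrimary` needs no archimedean input —
  Greenberg p. 107: «For archimedean `v`, one easily verifies that `𝒫_E^{(v)}(F) ≅ 𝒫_E^{(v)}(F_∞)^Γ`».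
  The K3 lane's `p ≠ 2` twin is `SprungLowerHalfAtThreeSplit.natCard_sharpFlatKerG_dvd_tamagawaProduct`
  (`p ≠ 2` entered only through `IsHondaSystem`, here ↦ the displayed clauses).
This is the half of COUNT♭ that needs no Poitou–Tate duality; it is also what the LOWER (Eisenstein) Miller
half consumes (`ord_p f♭(0) ≤ ord_p ∏ c_ℓ + ord_p #Sel`). HONEST FRAMING: kernel theorems about the tree's
objects under displayed hypotheses; nothing about any curve is asserted; no census cell moves; BSD is not
proved by any of this. Proof body of the main theorem adapted from the K3 lane (credit
`bsd-ssimc-k3c5-kdot-split` g7).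

References: [GreenbergLNM1716] R. Greenberg, LNM 1716 (1999), §3 Lemma 3.3 and p. 88; §4 p. 104,
pp. 106–107; [Sprung2024] F. Sprung, Adv. Math. 449 (2024) §5.2 Lemma 5.5 (p. 40); [Sprung2012] Lemma 2.3.
-/

set_option autoImplicit false
-- the Theorems namespace of this sub repeats the summit name by design (D-0017 nested layout)
set_option linter.dupNamespace false

noncomputable section

open scoped Classical NumberField

open NumberField IsDedekindDomain

universe u

namespace Summit.BirchSwinnertonDyer.BirchSwinnertonDyer.Theorems.SSFlatEC

open Literature.NumberTheory.EllipticCurves Literature.NumberTheory.GaloisRepresentations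
  WeierstrassCurve ZpExtension Literature.NumberTheory.EllipticCurves.Kobayashi2003
  Literature.NumberTheory.EllipticCurves.Sprung2017 Literature.NumberTheory.EllipticCurves.Sprung2012
  Literature.NumberTheory.EllipticCurves.Sprung2024 Literature.NumberTheory.EllipticCurves.IwasawaDual
  Literature.NumberTheory.EllipticCurves.IwasawaAlgebra
  Literature.NumberTheory.EllipticCurves.Rank1Residual Summit.BirchSwinnertonDyer.Rank1Residual.X5.O1

variable (W : WeierstrassCurve ℚ) [W.IsElliptic] [W.IsGloballyMinimal] (p : ℕ) [Fact p.Prime]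
  {v : HeightOneSpectrum (𝓞 ℚ)}

/-! ## §0 Arithmetic of the count -/

omit [Fact p.Prime] in
/-- The arithmetic of Greenberg's remark (LNM 1716 p. 104): if `k ∣ p^t` and `s ≥ 1`, then
`k · 1 = p^t · s` iff `k = p^t` and `s = 1`. [folklore] -/
theorem mul_one_eq_pow_mul_iff {k t s : ℕ} (hp : 1 < p) (hk : k ∣ p ^ t) (hs : 0 < s) :
    k * 1 = p ^ t * s ↔ k = p ^ t ∧ s = 1 := by
  constructor
  · intro h
    rw [mul_one] at h
    have hpt : 0 < p ^ t := pow_pos (lt_trans Nat.zero_lt_one hp) t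
    have hle : k ≤ p ^ t := Nat.le_of_dvd hpt hk
    have hs1 : s ≤ 1 := by
      have hmul : p ^ t * s ≤ p ^ t * 1 := by rw [mul_one, ← h]; exact hle
      exact Nat.le_of_mul_le_mul_left hmul hpt
    have hs' : s = 1 := le_antisymm hs1 hs
    subst hs'
    exact ⟨by rw [h, mul_one], rfl⟩
  · rintro ⟨rfl, rfl⟩
    rfl

/-! ## §1 `#ker g♭ ∣ p^{ord_p ∏ c_ℓ}` under the clauses, any `p`, cyclotomic `κ` -/

omit [W.IsGloballyMinimal] in
/-- A `p`-power dividing the natural number `T ≠ 0` divides `p^{ord_p T}`. [folklore] -/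
theorem dvd_pow_padicValNat_of_dvd_pow_of_dvd {k m T : ℕ} (hk : k ∣ p ^ m) (hkT : k ∣ T) (hT : T ≠ 0) :
    k ∣ p ^ padicValNat p T := by
  have hpP : p.Prime := Fact.out
  obtain ⟨j, -, rfl⟩ := (Nat.dvd_prime_pow hpP).mp hk
  exact pow_dvd_pow p ((padicValNat_dvd_iff_le hT).mp hkT)

/-- **`#ker g♭ = #(A♭_0/Sel_0)` divides `p^{ord_p ∏_ℓ c_ℓ}`** — the divisibility half of Sprung 2024
Lemma 5.5 / Greenberg Lemmas 4.4 + 4.7 for the ♭ chromatic Selmer group over `ℚ`, at ANY prime `p`, for a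
CYCLOTOMIC `ℤ_p`-extension `κ`, the place `v ∋ p`, a local `g` restricting to a generator, local points `c`
with levels, the `n ≥ 1` trace relation with `a_p` (`p ∣ a_p`) and the level-`0` generation clause ON
`c_0`, given no `p`-torsion in `E(ℚ_∞·ℚ_p)` (Lemma 2.3). Chain: `#ker g♭ ∣ ∏_{bad ℓ ≠ p} #𝒦_{ℓ,0}[p^∞]`
(`Sprung2024.natCard_sharpFlatKerG_dvd_prod_natCard_localTowerKerPrimary` fed with "`r_p` injective" =
`mem_localKerOver_of_flat_rat`) `= ∏ p^{ord_p c_ℓ}` (Greenberg p. 88, kernel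
`Rank1Residual.Additive.natCard_localTowerKerPrimary_zero_eq_pow_of_isCyclotomic`) `∣ ∏_ℓ c_ℓ ∣ ∏_v c_v`;
a `p`-power dividing `∏_v c_v` divides `p^{ord_p ∏_v c_v}`. No archimedean term occurs (Greenberg p. 107:
«For archimedean `v` … `𝒫_E^{(v)}(F) ≅ 𝒫_E^{(v)}(F_∞)^Γ`»; in the tree, the archimedean conditions of
`selmerGroupOver` at layer `0` and over `ℚ_∞` coincide class by class).
[cite: GreenbergLNM1716, §4 p. 104 and §3 Lemma 3.3, p. 88] [cite: Sprung2024, §5.2 proof of Lemma 5.5 (p. 40)] -/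
theorem natCard_flatKerG_dvd_pow_padicValNat_tamagawaProduct {κ : ZpExtension ℚ p} (hκ : κ.IsCyclotomic)
    (hpv : (p : 𝓞 ℚ) ∈ v.asIdeal)
    (hnt : ∀ P ∈ localTowerPointsOfEmb κ (closureEmb (K := ℚ) (v.adicCompletion ℚ)) W, p • P = 0 → P = 0)
    (hap : (p : ℤ) ∣ W.frobeniusTrace p) {g : Field.absoluteGaloisGroup (v.adicCompletion ℚ)}
    (hg : κ.IsTopGenerator (resGalOfEmb (closureEmb (K := ℚ) (v.adicCompletion ℚ)) g))
    {c : ℕ → localPoints W (v.adicCompletion ℚ)}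
    (hc : ∀ n, c n ∈ localLayerPointsOfEmb κ (closureEmb (K := ℚ) (v.adicCompletion ℚ)) W n)
    (hTr : ∀ n, 1 ≤ n → localTraceOfEmb κ (closureEmb (K := ℚ) (v.adicCompletion ℚ)) W n (n + 1)
      (c (n + 1)) = W.frobeniusTrace p • c n - c (n - 1))
    (hinj : ∀ z₀ : localLayerPointsOfEmb κ (closureEmb (K := ℚ) (v.adicCompletion ℚ)) W 0 →+ ℤ_[p],
      evalOn W (localLayerPointsOfEmb κ (closureEmb (K := ℚ) (v.adicCompletion ℚ)) W 0) z₀ (c 0) = 0 →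
        z₀ = 0)
    (hsat : ∀ a : ℤ_[p],
      (∃ z₀ : localLayerPointsOfEmb κ (closureEmb (K := ℚ) (v.adicCompletion ℚ)) W 0 →+ ℤ_[p],
        evalOn W (localLayerPointsOfEmb κ (closureEmb (K := ℚ) (v.adicCompletion ℚ)) W 0) z₀ (c 0) =
          p * a) →
      ∃ y : localLayerPointsOfEmb κ (closureEmb (K := ℚ) (v.adicCompletion ℚ)) W 0 →+ ℤ_[p],
        evalOn W (localLayerPointsOfEmb κ (closureEmb (K := ℚ) (v.adicCompletion ℚ)) W 0) y (c 0) = a) :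
    Nat.card (↥((sharpFlatSelmerInfty W κ (closureEmb (K := ℚ) (v.adicCompletion ℚ))
        (W.frobeniusTrace p) g c Chroma.flat).comap (W.layerToInfty κ 0)) ⧸
      (W.selmerLayer κ 0).addSubgroupOf
        ((sharpFlatSelmerInfty W κ (closureEmb (K := ℚ) (v.adicCompletion ℚ))
          (W.frobeniusTrace p) g c Chroma.flat).comap (W.layerToInfty κ 0))) ∣
      p ^ padicValNat p W.tamagawaProduct := by
  -- the finite set of bad places not above `p`
  have hbad : (W.badPlaces (𝓞 ℚ)).Finite := W.finite_badPlaces_holds (𝓞 ℚ)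
  let B : Finset (HeightOneSpectrum (𝓞 ℚ)) := hbad.toFinset
  let S : Finset (HeightOneSpectrum (𝓞 ℚ)) := B.filter fun w ↦ (p : 𝓞 ℚ) ∉ w.asIdeal
  have hB : ∀ w : HeightOneSpectrum (𝓞 ℚ), w ∈ B ↔ ¬ W.HasGoodReductionAt w := fun w ↦ by
    simp only [B, Set.Finite.mem_toFinset, WeierstrassCurve.badPlaces, Set.mem_setOf_eq]
  have hS : ∀ w : HeightOneSpectrum (𝓞 ℚ), w ∈ S ↔ ¬ W.HasGoodReductionAt w ∧ (p : 𝓞 ℚ) ∉ w.asIdeal :=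
    fun w ↦ by rw [Finset.mem_filter, hB]
  have hS' : ∀ w : HeightOneSpectrum (𝓞 ℚ), w ∉ S → (p : 𝓞 ℚ) ∉ w.asIdeal → W.HasGoodReductionAt w := by
    intro w hw hpw
    by_contra hng
    exact hw ((hS w).mpr ⟨hng, hpw⟩)
  -- `#ker g♭ ∣ ∏_{w ∈ S} #𝒦_{w,0}[p^∞]` ("`r_p` is injective" from the clauses, GEN 10)
  have h1 := natCard_sharpFlatKerG_dvd_prod_natCard_localTowerKerPrimary W p κ v hpv g c Chroma.flat
    (fun y hy ↦ mem_localKerOver_of_flat_rat W p κ hpv hnt hap hg hc hTr hinj hsat y hy) S hS'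
  -- `∏_{w ∈ S} #𝒦_{w,0}[p^∞] = ∏_{w ∈ S} p^{ord_p c_w} = p^{∑ ord_p c_w}` (Greenberg p. 88, kernel)
  have h2 : ∏ w ∈ S, Nat.card (W.localTowerKerPrimary κ (w.adicCompletion ℚ) 0) =
      p ^ ∑ w ∈ S, padicValNat p
        ((W.baseChange (w.adicCompletion ℚ)).localTamagawaNumber (w.adicCompletionIntegers ℚ)) := by
    rw [← Finset.prod_pow_eq_pow_sum]
    refine Finset.prod_congr rfl fun w hw ↦ ?_
    exact Summit.BirchSwinnertonDyer.Rank1Residual.Additive.natCard_localTowerKerPrimary_zero_eq_pow_of_isCyclotomic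
      W hκ ((hS w).mp hw).2
  -- `∏_{w ∈ S} #𝒦_{w,0}[p^∞] ∣ ∏_{w ∈ S} c_w ∣ ∏_v c_v`
  have h3 : ∏ w ∈ S, Nat.card (W.localTowerKerPrimary κ (w.adicCompletion ℚ) 0) ∣
      ∏ w ∈ S, (W.baseChange (w.adicCompletion ℚ)).localTamagawaNumber (w.adicCompletionIntegers ℚ) := by
    refine Finset.prod_dvd_prod_of_dvd _ _ fun w hw ↦ ?_
    rw [Summit.BirchSwinnertonDyer.Rank1Residual.Additive.natCard_localTowerKerPrimary_zero_eq_pow_of_isCyclotomic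
      W hκ ((hS w).mp hw).2]
    exact pow_padicValNat_dvd
  have hsupp : (Function.mulSupport fun w : HeightOneSpectrum (𝓞 ℚ) ↦
      (W.baseChange (w.adicCompletion ℚ)).localTamagawaNumber (w.adicCompletionIntegers ℚ)) ⊆ ↑B := by
    intro w hw
    rw [Finset.mem_coe, hB]
    intro hgw
    exact hw (W.localTamagawaNumber_eq_one_of_hasGoodReductionAt_holds w hgw)
  have h4 : ∏ w ∈ S, (W.baseChange (w.adicCompletion ℚ)).localTamagawaNumber (w.adicCompletionIntegers ℚ) ∣
      W.tamagawaProduct := by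
    rw [WeierstrassCurve.tamagawaProduct, finprod_eq_prod_of_mulSupport_subset _ hsupp]
    exact Finset.prod_dvd_prod_of_subset S B _ (Finset.filter_subset _ B)
  -- a `p`-power dividing `∏_v c_v ≠ 0` divides `p^{ord_p ∏_v c_v}`
  refine dvd_pow_padicValNat_of_dvd_pow_of_dvd p (m := ∑ w ∈ S, padicValNat p
    ((W.baseChange (w.adicCompletion ℚ)).localTamagawaNumber (w.adicCompletionIntegers ℚ)))
    (h2 ▸ h1) (h1.trans (h3.trans h4)) W.tamagawaProduct_pos'.ne'

end Summit.BirchSwinnertonDyer.BirchSwinnertonDyer.Theorems.SSFlatEC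

end
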